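/-
Copyright (c) 2026 the pub-hodgecm-mathlib formalisation cell (harness21).  Prover seat hodgecm-mathlib-F0P2-p09 (g2), Track B «K2-LIT»,
#184♮ = hLiu418 = `stmt-HodgeConjecture-24832`; socket #41, KIND W, organ (KW-fin), brick (KW-fin-dual) = the `hdual` PAYER at `n = 2` of
★-cand (KW-fin-supp) `K2LiuKindWFiniteSupportLetterOfLevel` (K2E3-p03 (g9) CENSUS 2026-09-05T00:26:14Z) — KW desk F0P2-p08 (g3) GO 00:27:42Z, LEAD F0P6-plan (g15),
box K2Liu-audit1 (g3).  THEOREMS ONLY (no `def`, no `instance`, no notation, no named-fact hypothesis, no `sorry`).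
-/
import Summits.HodgeConjecture.HodgeConjecture.Theorems.K2LiuKindWFiniteLetterDefs                 -- ★ `kindWLocalBall`, `mem_kindWLocalBall_iff`
import Summits.HodgeConjecture.HodgeConjecture.Theorems.K2LiuRankOneCornerCharacterReading        -- ★ (b2′) `unipDeltaChar_locToAdelic_nElem` (+ ★ `nElem`, bridge, `blkB_matA_nElem`)
import Summits.HodgeConjecture.HodgeConjecture.Theorems.K2LiuKindOneLineCharacterBoundTwoGeneral  -- ★ (ρ3) ED. 2 `valued_entry_mul_le_of_forall_test` (+ ★ (ρ3) §1–§3)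
import Summits.HodgeConjecture.HodgeConjecture.Theorems.K2LiuSiegelMiddleStabilizerNontrivial     -- ★ `exists_gramR_eq_diagonal`
import Literature.NumberTheory.Weil1982.UnitaryLocalRingBaseField                                -- ★ `algebraMap_trace_localRing` (`Tr ⊗ 1 = 1 + c ⊗ 1`)
import HarnessLib

/-!
# Crux `HLiu418`, socket #41, KIND W, brick (KW-fin-dual): `ψ_S ≡ 1` ON THE BALL `B_v(a) ⊂ N_Δ(L⁺_v)` ⟹ THE ENTRIES OF `S` LIE IN THE DUAL BALL (`n = 2`)

Cell `hodgecm-mathlib`, crux item hLiu418 = `stmt-HodgeConjecture-24832` (helper lane `--supports … --as helper`, count-neutral), route of record `HCCMUnconditional`;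
squad K2 ∕ K2Liu (L1), road `K2_Liu`, socket #41, KIND W, organ (KW-fin) (KW desk F0P2-p08 (g3)): the (KW-fin-supp) file of K2E3-p03 (g9) proves «`Ffin ≠ 0` ⟹ `ψ_S ≡ 1`
on the invariance ball» and leaves BY VALUE the DUAL-LATTICE letter
`hdual : (∀ u₀ ∈ kindWLocalBall v π a, ψ_S(ι_v u₀) = 1) → |S_{ab}|_w ≤ exp(…)` («ψ_S trivial on the ball of exponent `a` ⟹ the entries of `S` lie in the dual ball»).
THIS FILE PAYS IT AT `n = 2` in the KW frame `(L, e : Fin N × Fin M ≃ Fin 2, dV, dW)`: the ball (★ `K2LiuKindWFiniteLetterDefs.kindWLocalBall`, `|B(y)_{ij,w}|_w ≤ |ι_w π|^a`)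
contains the test unipotents `n(X)` (★ Lit `nElem`, ★ `blkB_matA_nElem`: `B(n(X)) = X`) of the four ELEMENTARY SKEW TEST MATRICES `X₀₁(ι_v u·y)`, `X₁₀(ι_v u·y)` (`y ∈ {1, δ̃}`),
`ι_v u·δ̃·E₀₀`, `ι_v u·δ̃·E₁₁` of ★ (ρ3) as soon as `|u|_v ≤ exp(−(a + 2D))`, `D ∈ ℕ` the LOCAL DEFECT of the datum (`|g₀∕g₁|_v, |g₁∕g₀|_v ≤ exp D`, `|δ|_{w′} ≤ exp(e(w′|v)·D)`;
`D = 0` at every good place); on them `ψ_S(ι_v n(X)) = ψ_{L⁺,v}(Tr(−⅟2·tr(S·X)))` (★ (b2′) `unipDeltaChar_locToAdelic_nElem`), so the four `htest··` letters of ★ (ρ3) ED. 2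
`K2LiuKindOneLineCharacterBoundTwoGeneral.valued_entry_mul_le_of_forall_test` hold with depth `N = a + 2D`, whence
**`|2|_w·|δ|_w·|S_{ab}|_w ≤ max(|δ|_w, 1)·exp(e(w|v)·(a + 2D − d_v))`** at EVERY place `w ∣ v` (`d_v` = conductor exponent of `ψ_{L⁺,v} = adeleAddCharAt (Fp L) v`).
MATHEMATICS: [Shimura1997, §18.4 Prop. 18.14] (a Fourier coefficient invariant under a lattice of unipotents has its index in the dual lattice), [Tate1950, §2.2] ∕
[BushnellHenniart2006, §1.7] (`{y : ψ(xy) = 1 ∀ x ∈ 𝔭^N} = 𝔭^{d−N}`), [KudlaRallis1994, §2] (the balls `B_v(a)` of the local Whittaker integrals), [WeilBNT1967, Ch. VIII §4]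
(the local trace `Tr_{L⊗L⁺_v ∕ L⁺_v} = 1 + c`, ★ `algebraMap_trace_localRing`).
* §1 (generic `n`) `valued_toPlace_uniformizer_zpow` (`|ι_w π|^a = exp(−e(w|v)·a)`), `trace_letters` (the `hτ hτadd hτs` letters of ★ (ρ3) for `τ := Algebra.trace`),
  `skew_localRing_of_mem_skewMatrices` (rational `gramR ⊗ L`-skew ⟹ local `gramS`-skew), `nElem_mem_unipDeltaLoc`, `nElem_mem_kindWLocalBall`, `addChar_trace_eq_one_of_ball`.
* §2 (`n = 2`) `forall_valued_fin_two_apply_le` (entry bookkeeping) and the HEAD **`valued_entry_mul_le_of_unipDeltaChar_eq_one_on_ball`**.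
HONEST LABEL.  Count-neutral helper; closes no socket by itself; `HC_CM` is proved only modulo the 7 printed citations (2 remaining named inputs:
hLiu418 = `stmt-HodgeConjecture-24832`, h413 = `stmt-HodgeConjecture-24833`) until rung 0 closes.

## References
* [Shimura1997] G. Shimura, *Euler products and Eisenstein series*, CBMS 93 (1997): §18.4 Prop. 18.14.
* [Tate1950] J. Tate, thesis (1950), in Cassels–Fröhlich (1967) Ch. XV: §2.2.
* [BushnellHenniart2006] C. J. Bushnell, G. Henniart, *The local Langlands conjecture for GL(2)*, Grundlehren 335 (2006): §1.7.
* [KudlaRallis1994] S. Kudla, S. Rallis, Ann. of Math. 140 (1994): §2 (local Whittaker integrals over balls).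
* [WeilBNT1967] A. Weil, *Basic Number Theory* (1967): Ch. VIII §4.
-/

set_option autoImplicit false
-- the mandated namespace repeats the single-problem summit's segment (`HodgeConjecture.HodgeConjecture`)
set_option linter.dupNamespace false

noncomputable section

open scoped Matrix NNReal WithZero
open NumberField IsDedekindDomain Matrix
open Literature.NumberTheory.Automorphic Literature.NumberTheory.Automorphic.UnitaryGroup Literature.NumberTheory.GaloisRepresentations
open Literature.NumberTheory.GelbartRogawski1991 Literature.NumberTheory.GelbartRogawski1991.GRConstruction
open Literature.NumberTheory.GelbartRogawski1991.AdaptedBlocks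
open Literature.NumberTheory.GelbartRogawski1991.UnitaryDualPair Literature.NumberTheory.GelbartRogawski1991.UnitaryDualPair.LocalSplitting
open Literature.NumberTheory.K2Lit Literature.NumberTheory.K2Lit.SiegelDoubled Literature.NumberTheory.K2Lit.LocalSiegelDoubled
open Summit.HodgeConjecture.HodgeConjecture.Cruxes.HLiu418.K2LiuSiegelUnipotentLocalDefs
open Summit.HodgeConjecture.HodgeConjecture.Cruxes.HLiu418.K2LiuSiegelUnipotentFourierDefs
open Summit.HodgeConjecture.HodgeConjecture.Cruxes.HLiu418.K2LiuSiegelUnipotentCharacters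
open Summit.HodgeConjecture.HodgeConjecture.Cruxes.HLiu418.K2LiuKindWFiniteLetterDefs
open Summit.HodgeConjecture.HodgeConjecture.Cruxes.HLiu418.K2LiuRankOneCornerCharacterReading (unipDeltaChar_locToAdelic_nElem)
open Summit.HodgeConjecture.HodgeConjecture.Cruxes.HLiu418.K2LiuUnipDeltaLocBridge (mem_unipDeltaLoc_iff_mem_unipDeltaLocal)
open Summit.HodgeConjecture.HodgeConjecture.Cruxes.HLiu418.K2LiuUnipDeltaLocalCoordinates (blkB_matA_nElem)
open Summit.HodgeConjecture.HodgeConjecture.Cruxes.HLiu418.K2LiuSiegelMiddleStabilizerNontrivial (exists_gramR_eq_diagonal)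
open Summit.HodgeConjecture.HodgeConjecture.Cruxes.HLiu418.K2LiuKindOneLineCharacterReading (algebraMap_localRing_apply)
open Summit.HodgeConjecture.HodgeConjecture.Cruxes.HLiu418.K2LiuKindOneLineCharacterBoundTwo
open Summit.HodgeConjecture.HodgeConjecture.Cruxes.HLiu418.K2LiuKindOneLineCharacterBoundTwoGeneral
open Literature.NumberTheory.Weil1982.UnitaryFinTopForm (algebraMap_trace_localRing)

namespace Summit.HodgeConjecture.HodgeConjecture.Cruxes.HLiu418.K2LiuKindWFiniteDualLatticeLetter

variable (L : Type) [Field L] [NumberField L] [IsCMField L]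

/-! ## §1 Local letters (generic rank `n`) -/

section Local

variable {N M n : ℕ} (e : Fin N × Fin M ≃ Fin n)
  (dV : Fin N → L) (hdV : ∀ i, IsCMField.complexConj L (dV i) = dV i)
  (dW : Fin M → L) (hdW : ∀ i, IsCMField.complexConj L (dW i) = dW i)
  (v : HeightOneSpectrum (𝓞 (Fp L)))

omit [IsCMField L] in
/-- **`|ι_w π|^a = exp(−e(w|v)·a)`** for a uniformiser `π` of `L⁺_v` (`|π|_v = exp(−1)`; ★ `valued_toPlace`: `|ι_w y| = |y|_v^{e(w|v)}`). [cite: Tate1950, §2.2] -/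
theorem valued_toPlace_uniformizer_zpow {π : v.adicCompletion (Fp L)} (hπ : Valued.v π = WithZero.exp (-1 : ℤ)) (w : UnitaryGroup.PlacesOver L v) (a : ℤ) :
    Valued.v (toPlace v w π) ^ a = WithZero.exp (-((v.asIdeal.ramificationIdx' w.1.asIdeal : ℤ) * a)) := by
  rw [valued_toPlace, hπ, ← WithZero.exp_nsmul, ← WithZero.exp_zsmul]
  congr 1
  simp only [smul_eq_mul, nsmul_eq_mul]
  ring

/-- **THE LOCAL TRACE LETTERS of ★ (ρ3)** for `τ := Tr_{L⊗L⁺_v ∕ L⁺_v}`: `ι_v(τ r) = r + σ r` (★ `algebraMap_trace_localRing`), additivity, `L⁺_v`-linearity `τ(ι_v z · r) = z · τ r`.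
[cite: WeilBNT1967, Ch. VIII §4] -/
theorem trace_letters :
    (∀ r : LocalRing L v, toLocalRing L v (Algebra.trace (v.adicCompletion (Fp L)) (LocalRing L v) r) = r + conjLocal L (IsCMField.complexConj L) v r) ∧
    (∀ r r' : LocalRing L v, Algebra.trace (v.adicCompletion (Fp L)) (LocalRing L v) (r + r') =
      Algebra.trace (v.adicCompletion (Fp L)) (LocalRing L v) r + Algebra.trace (v.adicCompletion (Fp L)) (LocalRing L v) r') ∧
    (∀ (z : v.adicCompletion (Fp L)) (r : LocalRing L v), Algebra.trace (v.adicCompletion (Fp L)) (LocalRing L v) (toLocalRing L v z * r) =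
      z * Algebra.trace (v.adicCompletion (Fp L)) (LocalRing L v) r) := by
  refine ⟨fun r => ?_, fun r r' => map_add _ r r', fun z r => ?_⟩
  · rw [← algebraMap_localRing_eq]
    exact algebraMap_trace_localRing L v r
  · rw [← algebraMap_localRing_eq, ← Algebra.smul_def, map_smul, smul_eq_mul]

/-- **RATIONAL SKEW ⟹ LOCAL SKEW**: `S ∈ Skew_{gramR ⊗ L}(L)` (index group of the Fourier expansion) ⟹ `((S⊗1).map σ)ᵀ·G + G·(S⊗1) = 0` for `G = gramS = gramR ⊗ 1 ∈ M_n(L ⊗ L⁺_v)`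
(★ `map_mem_skewMatrices` along `L → L ⊗ L⁺_v`, ★ `conjLocal_algebraMap`, ★ `toPlace_coe`). [cite: Shimura1997, §18.1] -/
theorem skew_localRing_of_mem_skewMatrices {S : Matrix (Fin n) (Fin n) L}
    (hS : S ∈ skewMatrices ((IsCMField.complexConj L : L ≃ₐ[Fp L] L) : L →+* L) ((gramR L e dV hdV dW hdW).map (algebraMap (Fp L) L))) :
    ((S.map (algebraMap L (LocalRing L v))).map (conjLocal L (IsCMField.complexConj L) v))ᵀ * gramS (Fp L) L v n (gramR L e dV hdV dW hdW) +
      gramS (Fp L) L v n (gramR L e dV hdV dW hdW) * S.map (algebraMap L (LocalRing L v)) = 0 := by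
  have hT : ((gramR L e dV hdV dW hdW).map (algebraMap (Fp L) L)).map (algebraMap L (LocalRing L v)) = gramS (Fp L) L v n (gramR L e dV hdV dW hdW) := by
    refine Matrix.ext fun i j => funext fun w => ?_
    rw [Matrix.map_apply, Matrix.map_apply, algebraMap_localRing_apply]
    show _ = toLocalRing L v (algebraMap (Fp L) (v.adicCompletion (Fp L)) (gramR L e dV hdV dW hdW i j)) w
    rw [toLocalRing_apply]
    exact (toPlace_coe v w (gramR L e dV hdV dW hdW i j)).symm
  have hσS : (S.map ((IsCMField.complexConj L : L ≃ₐ[Fp L] L) : L →+* L)).map (algebraMap L (LocalRing L v)) =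
      (S.map (algebraMap L (LocalRing L v))).map (conjLocal L (IsCMField.complexConj L) v) := by
    ext i j
    simp only [Matrix.map_apply, RingHom.coe_coe, conjLocal_algebraMap]
  have h := map_mem_skewMatrices (σ' := conjLocal L (IsCMField.complexConj L) v) (algebraMap L (LocalRing L v))
    (fun x => by rw [RingHom.coe_coe, conjLocal_algebraMap]) hS
  rw [mem_skewMatrices_iff, hT] at h
  rwa [add_comm] at h

/-- the test unipotent `n(t)` (★ Lit `nElem`, `t` a `gramS`-skew block) lies in `N_Δ(L⁺_v)` (★ `nElem_mem_unipDeltaLocal` through the ★ `unipDeltaLoc` ↔ `unipDeltaLocal` bridge).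
[cite: KudlaRallis1994, §2] -/
theorem nElem_mem_unipDeltaLoc {t : Matrix (Fin n) (Fin n) (LocalRing L v)}
    (ht : (t.map (conjLocal L (IsCMField.complexConj L) v))ᵀ * gramS (Fp L) L v n (gramR L e dV hdV dW hdW) + gramS (Fp L) L v n (gramR L e dV hdV dW hdW) * t = 0) :
    nElem (Fp L) L (IsCMField.complexConj L) v n (hermD_eq_map_gramD L e dV hdV dW hdW) t ht ∈ unipDeltaLoc L e dV hdV dW hdW v :=
  (mem_unipDeltaLoc_iff_mem_unipDeltaLocal L e dV hdV dW hdW v _).2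
    (nElem_mem_unipDeltaLocal (Fp L) L (IsCMField.complexConj L) v n (hermD_eq_map_gramD L e dV hdV dW hdW) t ht)

/-- **THE TEST UNIPOTENTS SIT IN THE BALL**: if every entry of `t` has `|t_{ij,w}|_w ≤ |ι_w π|^a` at every `w ∣ v`, then `n(t) ∈ kindWLocalBall v π a` (`B(n(t)) = t`, ★ `blkB_matA_nElem`).
[cite: KudlaRallis1994, §2] -/
theorem nElem_mem_kindWLocalBall {t : Matrix (Fin n) (Fin n) (LocalRing L v)}
    (ht : (t.map (conjLocal L (IsCMField.complexConj L) v))ᵀ * gramS (Fp L) L v n (gramR L e dV hdV dW hdW) + gramS (Fp L) L v n (gramR L e dV hdV dW hdW) * t = 0)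
    (π : v.adicCompletion (Fp L)) (a : ℤ) (hta : ∀ (i j : Fin n) (w : UnitaryGroup.PlacesOver L v), Valued.v (t i j w) ≤ Valued.v (toPlace v w π) ^ a) :
    (⟨nElem (Fp L) L (IsCMField.complexConj L) v n (hermD_eq_map_gramD L e dV hdV dW hdW) t ht, nElem_mem_unipDeltaLoc L e dV hdV dW hdW v ht⟩ :
        ↥(unipDeltaLoc L e dV hdV dW hdW v)) ∈ kindWLocalBall L e dV hdV dW hdW v π a := by
  rw [mem_kindWLocalBall_iff]
  intro i j w
  rw [blkB_matA_nElem (Fp L) L (IsCMField.complexConj L) v n (hermD_eq_map_gramD L e dV hdV dW hdW) ht]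
  exact hta i j w

/-- **`ψ_S ≡ 1` ON THE BALL ⟹ `ψ_{L⁺,v}(Tr(−⅟2·tr(S·t))) = 1` FOR EVERY SKEW `t` WITH ENTRIES IN THE BALL** (★ (b2′) `unipDeltaChar_locToAdelic_nElem` on the test unipotent `n(t)`).
[cite: Shimura1997, §18.4 Prop. 18.14] [cite: KudlaRallis1994, §2] -/
theorem addChar_trace_eq_one_of_ball (S : Matrix (Fin n) (Fin n) L) {π : v.adicCompletion (Fp L)} {a : ℤ}
    (h1 : ∀ u₀ : ↥(unipDeltaLoc L e dV hdV dW hdW v), u₀ ∈ kindWLocalBall L e dV hdV dW hdW v π a →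
      unipDeltaChar L e dV hdV dW hdW S (locToAdelic L e dV hdV dW hdW v
        (u₀ : UnitaryGroup.localPi L (IsCMField.complexConj L) (n + n) (hermD L e dV hdV dW hdW) v)) = 1)
    {t : Matrix (Fin n) (Fin n) (LocalRing L v)}
    (ht : (t.map (conjLocal L (IsCMField.complexConj L) v))ᵀ * gramS (Fp L) L v n (gramR L e dV hdV dW hdW) + gramS (Fp L) L v n (gramR L e dV hdV dW hdW) * t = 0)
    (hta : ∀ (i j : Fin n) (w : UnitaryGroup.PlacesOver L v), Valued.v (t i j w) ≤ Valued.v (toPlace v w π) ^ a) :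
    adeleAddCharAt (Fp L) v (Algebra.trace (v.adicCompletion (Fp L)) (LocalRing L v)
      (-(⅟(2 : LocalRing L v) * Matrix.trace (S.map (algebraMap L (LocalRing L v)) * t)))) = 1 := by
  rw [← unipDeltaChar_locToAdelic_nElem L e dV hdV dW hdW v S ht]
  exact h1 ⟨_, nElem_mem_unipDeltaLoc L e dV hdV dW hdW v ht⟩ (nElem_mem_kindWLocalBall L e dV hdV dW hdW v ht π a hta)

end Local

/-! ## §2 The head at `n = 2` -/

section Two

variable {N M : ℕ} (e : Fin N × Fin M ≃ Fin 2)
  (dV : Fin N → L) (hdV : ∀ i, IsCMField.complexConj L (dV i) = dV i)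
  (dW : Fin M → L) (hdW : ∀ i, IsCMField.complexConj L (dW i) = dW i)
  (v : HeightOneSpectrum (𝓞 (Fp L)))

omit [IsCMField L] in
/-- entry bookkeeping for a `2 × 2` test matrix at a place `w`. [folklore] -/
theorem forall_valued_fin_two_apply_le (p q r s : LocalRing L v) (w : UnitaryGroup.PlacesOver L v) (B : ℤᵐ⁰)
    (hp : Valued.v (p w) ≤ B) (hq : Valued.v (q w) ≤ B) (hr : Valued.v (r w) ≤ B) (hs : Valued.v (s w) ≤ B) :
    ∀ i j : Fin 2, Valued.v ((!![p, q; r, s] : Matrix (Fin 2) (Fin 2) (LocalRing L v)) i j w) ≤ B := by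
  intro i j
  fin_cases i <;> fin_cases j <;>
    simpa only [Matrix.of_apply, Matrix.cons_val', Matrix.cons_val_zero, Matrix.cons_val_one, Matrix.cons_val_fin_one, Matrix.empty_val', Fin.isValue,
      Fin.zero_eta, Fin.mk_one]

/-- **(KW-fin-dual) THE DUAL-LATTICE LETTER AT `n = 2`.**  KW frame `(L, e : Fin N × Fin M ≃ Fin 2, dV, dW)`, `v` ANY finite place of `L⁺`, `π` a uniformiser of `L⁺_v`, `d` the
conductor exponent of `ψ_{L⁺,v} = adeleAddCharAt (Fp L) v`, `g_k = gramR_{kk}` (`≠ 0`; ★ `gramR_apply_same_ne_zero`), `D ∈ ℕ` a LOCAL DEFECT of the datum (`|g₀∕g₁|_v, |g₁∕g₀|_v ≤ exp D`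
and `|δ|_{w′} ≤ exp(e(w′|v)·D)` for all `w′ ∣ v`; `D = 0` at every good `v`), `S ∈ Skew_{gramR ⊗ L}(L)` a Fourier index, `a ∈ ℤ` the ball exponent.  IF `ψ_S(ι_v u₀) = 1` for every
`u₀ ∈ kindWLocalBall v π a`, THEN at every `w ∣ v` and for all entries
**`|2|_w · |δ|_w · |S_{a′b′}|_w ≤ max(|δ|_w, 1) · exp(e(w|v)·(a + 2D − d))`** — the four elementary skew test unipotents of depth `a + 2D` lie in the ball (§1), ★ (b2′) reads
`ψ_S` on them as `ψ_{L⁺,v}(Tr(−⅟2 tr(S·X)))`, and ★ (ρ3) ED. 2 `valued_entry_mul_le_of_forall_test` concludes.  (At a good place: `|S_{a′b′}|_w ≤ exp(a − d)`.)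
[cite: Shimura1997, §18.4 Prop. 18.14] [cite: Tate1950, §2.2] [cite: BushnellHenniart2006, §1.7] [cite: KudlaRallis1994, §2] -/
theorem valued_entry_mul_le_of_unipDeltaChar_eq_one_on_ball
    {π : v.adicCompletion (Fp L)} (hπ : Valued.v π = WithZero.exp (-1 : ℤ))
    {d : ℤ} (hψ : (adeleAddCharAt (Fp L) v).HasConductorExp d)
    (hg : ∀ k : Fin 2, gramR L e dV hdV dW hdW k k ≠ 0) (D : ℕ)
    (hDg : Valued.v (algebraMap (Fp L) (v.adicCompletion (Fp L)) (gramR L e dV hdV dW hdW 0 0) *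
        (algebraMap (Fp L) (v.adicCompletion (Fp L)) (gramR L e dV hdV dW hdW 1 1))⁻¹) ≤ WithZero.exp (D : ℤ) ∧
      Valued.v (algebraMap (Fp L) (v.adicCompletion (Fp L)) (gramR L e dV hdV dW hdW 1 1) *
        (algebraMap (Fp L) (v.adicCompletion (Fp L)) (gramR L e dV hdV dW hdW 0 0))⁻¹) ≤ WithZero.exp (D : ℤ))
    (hDδ : ∀ w' : UnitaryGroup.PlacesOver L v,
      Valued.v ((imagUnit L : L) : w'.1.adicCompletion L) ≤ WithZero.exp ((v.asIdeal.ramificationIdx' w'.1.asIdeal : ℤ) * D))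
    (S : Matrix (Fin 2) (Fin 2) L)
    (hS : S ∈ skewMatrices ((IsCMField.complexConj L : L ≃ₐ[Fp L] L) : L →+* L) ((gramR L e dV hdV dW hdW).map (algebraMap (Fp L) L)))
    (a : ℤ)
    (h1 : ∀ u₀ : ↥(unipDeltaLoc L e dV hdV dW hdW v), u₀ ∈ kindWLocalBall L e dV hdV dW hdW v π a →
      unipDeltaChar L e dV hdV dW hdW S (locToAdelic L e dV hdV dW hdW v
        (u₀ : UnitaryGroup.localPi L (IsCMField.complexConj L) (2 + 2) (hermD L e dV hdV dW hdW) v)) = 1)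
    (w : UnitaryGroup.PlacesOver L v) (a' b' : Fin 2) :
    Valued.v ((2 : L) : w.1.adicCompletion L) * Valued.v ((imagUnit L : L) : w.1.adicCompletion L) * Valued.v ((S a' b' : L) : w.1.adicCompletion L) ≤
      max (Valued.v ((imagUnit L : L) : w.1.adicCompletion L)) 1 *
        WithZero.exp ((v.asIdeal.ramificationIdx' w.1.asIdeal : ℤ) * (a + 2 * (D : ℤ) - d)) := by
  haveI : Algebra.IsQuadraticExtension (Fp L) L := IsCMField.isQuadraticExtension L
  -- the frame letters
  set ι := toLocalRing L v with hιdef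
  set σ := conjLocal L (IsCMField.complexConj L) v with hσdef
  set δt := algebraMap L (LocalRing L v) (imagUnit L) with hδt
  set G := gramS (Fp L) L v 2 (gramR L e dV hdV dW hdW) with hGdef
  set g₀ := algebraMap (Fp L) (v.adicCompletion (Fp L)) (gramR L e dV hdV dW hdW 0 0) with hg₀
  set g₁ := algebraMap (Fp L) (v.adicCompletion (Fp L)) (gramR L e dV hdV dW hdW 1 1) with hg₁
  set Nt : ℤ := a + 2 * (D : ℤ) with hNt
  obtain ⟨tg, htg⟩ := exists_gramR_eq_diagonal L e dV hdV dW hdW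
  have hGapply : ∀ i j, G i j = ι (algebraMap (Fp L) (v.adicCompletion (Fp L)) (gramR L e dV hdV dW hdW i j)) := fun i j => rfl
  have hG01 : G 0 1 = 0 := by rw [hGapply, htg, Matrix.diagonal_apply_ne _ (by decide), map_zero, map_zero]
  have hG10 : G 1 0 = 0 := by rw [hGapply, htg, Matrix.diagonal_apply_ne _ (by decide), map_zero, map_zero]
  have hG00 : G 0 0 = ι g₀ := hGapply 0 0
  have hG11 : G 1 1 = ι g₁ := hGapply 1 1
  have hg₀0 : g₀ ≠ 0 := (map_ne_zero_iff _ (RingHom.injective _)).2 (hg 0)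
  have hg₁0 : g₁ ≠ 0 := (map_ne_zero_iff _ (RingHom.injective _)).2 (hg 1)
  obtain ⟨hτ, hτadd, hτs⟩ := trace_letters L v
  have hS' := skew_localRing_of_mem_skewMatrices L e dV hdV dW hdW v hS
  have hσσ : ∀ r : LocalRing L v, σ (σ r) = r := fun r => conjLocal_conjLocal (IsCMField.complexConj L) v (complexConj_imagUnit L) (imagUnit_ne_zero L) r
  have hσι : ∀ z, σ (ι z) = ι z := fun z => by rw [hσdef, hιdef, conjLocal_toLocalRing]
  have hσδ : σ δt = -δt := by rw [hδt, hσdef, conjLocal_algebraMap, complexConj_imagUnit, map_neg]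
  have hG0σ : σ (G 0 0) = G 0 0 := by rw [hG00]; exact hσι g₀
  have hG1σ : σ (G 1 1) = G 1 1 := by rw [hG11]; exact hσι g₁
  have hg1u : G 1 1 * ι g₁⁻¹ = 1 := by rw [hG11, ← map_mul, mul_inv_cancel₀ hg₁0, map_one]
  have hg0u : G 0 0 * ι g₀⁻¹ = 1 := by rw [hG00, ← map_mul, mul_inv_cancel₀ hg₀0, map_one]
  have hg1σ : σ (ι g₁⁻¹) = ι g₁⁻¹ := hσι _
  have hg0σ : σ (ι g₀⁻¹) = ι g₀⁻¹ := hσι _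
  have hG0inv : G 0 0 * ι g₁⁻¹ = ι (g₀ * g₁⁻¹) := by rw [hG00, ← map_mul]
  have hG1inv : G 1 1 * ι g₀⁻¹ = ι (g₁ * g₀⁻¹) := by rw [hG11, ← map_mul]
  -- `ψ_S ≡ 1` on the ball, read on a skew test matrix whose entries have `|X_{ij,w′}| ≤ exp(−e(w′|v)·a)`
  have hball : ∀ (X : Matrix (Fin 2) (Fin 2) (LocalRing L v)) (hX : (X.map σ)ᵀ * G + G * X = 0),
      (∀ (i j : Fin 2) (w' : UnitaryGroup.PlacesOver L v), Valued.v (X i j w') ≤ WithZero.exp (-((v.asIdeal.ramificationIdx' w'.1.asIdeal : ℤ) * a))) →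
      adeleAddCharAt (Fp L) v (Algebra.trace (v.adicCompletion (Fp L)) (LocalRing L v)
        (-(⅟(2 : LocalRing L v) * Matrix.trace (S.map (algebraMap L (LocalRing L v)) * X)))) = 1 :=
    fun X hX hXa => addChar_trace_eq_one_of_ball L e dV hdV dW hdW v S h1 hX fun i j w' =>
      (hXa i j w').trans_eq (valued_toPlace_uniformizer_zpow L v hπ w' a).symm
  -- sizes: `|ι_{w′} u| ≤ exp(−e·Nt)`, `|y_{w′}|, |σ y_{w′}| ≤ exp(e·D)`, `|ι_{w′} c| ≤ exp(e·D)`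
  have he0 : ∀ w' : UnitaryGroup.PlacesOver L v, (0 : ℤ) ≤ (v.asIdeal.ramificationIdx' w'.1.asIdeal : ℤ) := fun w' => Nat.cast_nonneg _
  have hD0 : (0 : ℤ) ≤ (D : ℤ) := Nat.cast_nonneg _
  have hιle : ∀ (c : v.adicCompletion (Fp L)) (k : ℤ), Valued.v c ≤ WithZero.exp k → ∀ w' : UnitaryGroup.PlacesOver L v,
      Valued.v (ι c w') ≤ WithZero.exp ((v.asIdeal.ramificationIdx' w'.1.asIdeal : ℤ) * k) := fun c k hc w' => by
    rw [hιdef, toLocalRing_apply]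
    exact valued_toPlace_le_exp_mul L v w' hc
  have hy : ∀ y : LocalRing L v, (y = 1 ∨ y = δt) → ∀ w' : UnitaryGroup.PlacesOver L v,
      Valued.v (y w') ≤ WithZero.exp ((v.asIdeal.ramificationIdx' w'.1.asIdeal : ℤ) * D) ∧
        Valued.v (σ y w') ≤ WithZero.exp ((v.asIdeal.ramificationIdx' w'.1.asIdeal : ℤ) * D) := by
    rintro y (rfl | rfl) w'
    · have h1le : (1 : ℤᵐ⁰) ≤ WithZero.exp ((v.asIdeal.ramificationIdx' w'.1.asIdeal : ℤ) * D) := by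
        rw [← WithZero.exp_zero]
        exact WithZero.exp_le_exp.2 (mul_nonneg (he0 w') hD0)
      rw [map_one, Pi.one_apply, Valuation.map_one]
      exact ⟨h1le, h1le⟩
    · have hδw : Valued.v (δt w') = Valued.v ((imagUnit L : L) : w'.1.adicCompletion L) := by rw [hδt, algebraMap_localRing_apply]
      refine ⟨by rw [hδw]; exact hDδ w', ?_⟩
      rw [hσδ, Pi.neg_apply, Valuation.map_neg, hδw]
      exact hDδ w'
  have hcoef : ∀ c : v.adicCompletion (Fp L), Valued.v c ≤ WithZero.exp (D : ℤ) → ∀ y : LocalRing L v, (y = 1 ∨ y = δt) →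
      ∀ u : v.adicCompletion (Fp L), Valued.v u ≤ WithZero.exp (-Nt) → ∀ w' : UnitaryGroup.PlacesOver L v,
      Valued.v ((-(ι c * σ (ι u * y))) w') ≤ WithZero.exp (-((v.asIdeal.ramificationIdx' w'.1.asIdeal : ℤ) * a)) ∧
        Valued.v ((ι u * y) w') ≤ WithZero.exp (-((v.asIdeal.ramificationIdx' w'.1.asIdeal : ℤ) * a)) := by
    intro c hc y hy' u hu w'
    obtain ⟨hy1, hy2⟩ := hy y hy' w'
    have hcw := hιle c D hc w'
    have huw := hιle u (-Nt) hu w'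
    refine ⟨?_, ?_⟩
    · rw [Pi.neg_apply, Valuation.map_neg, map_mul, hσι, Pi.mul_apply, Pi.mul_apply, Valuation.map_mul, Valuation.map_mul]
      calc Valued.v (ι c w') * (Valued.v (ι u w') * Valued.v (σ y w'))
          ≤ WithZero.exp ((v.asIdeal.ramificationIdx' w'.1.asIdeal : ℤ) * D) *
              (WithZero.exp ((v.asIdeal.ramificationIdx' w'.1.asIdeal : ℤ) * -Nt) * WithZero.exp ((v.asIdeal.ramificationIdx' w'.1.asIdeal : ℤ) * D)) :=
            mul_le_mul' hcw (mul_le_mul' huw hy2)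
        _ = WithZero.exp (-((v.asIdeal.ramificationIdx' w'.1.asIdeal : ℤ) * a)) := by
            rw [← WithZero.exp_add, ← WithZero.exp_add, hNt]
            congr 1
            ring
    · rw [Pi.mul_apply, Valuation.map_mul]
      calc Valued.v (ι u w') * Valued.v (y w')
          ≤ WithZero.exp ((v.asIdeal.ramificationIdx' w'.1.asIdeal : ℤ) * -Nt) * WithZero.exp ((v.asIdeal.ramificationIdx' w'.1.asIdeal : ℤ) * D) :=
            mul_le_mul' huw hy1
        _ = WithZero.exp ((v.asIdeal.ramificationIdx' w'.1.asIdeal : ℤ) * -Nt + (v.asIdeal.ramificationIdx' w'.1.asIdeal : ℤ) * D) :=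
            (WithZero.exp_add _ _).symm
        _ ≤ WithZero.exp (-((v.asIdeal.ramificationIdx' w'.1.asIdeal : ℤ) * a)) :=
            WithZero.exp_le_exp.2 (by rw [hNt]; nlinarith [he0 w', hD0])
  have h0le : ∀ (w' : UnitaryGroup.PlacesOver L v) (B : ℤᵐ⁰), Valued.v ((0 : LocalRing L v) w') ≤ B := fun w' B => by
    rw [Pi.zero_apply, Valuation.map_zero]
    exact zero_le
  -- ★ (ρ3) ED. 2 with depth `Nt = a + 2D`: the four test letters are read off the ball
  refine valued_entry_mul_le_of_forall_test L v hψ hτ hτadd hτs w G hG01 hG10 hg₀0 hg₁0 hG00 hG11 S hS' Nt ?_ ?_ ?_ ?_ a' b'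
  · -- `X₀₁(ι u · y)`
    intro u hu y hy'
    refine hball _ (skew_test01 σ hσσ G hG01 hG10 hG0σ (ι g₁⁻¹) hg1u hg1σ (ι u * y)) fun i j w' => ?_
    obtain ⟨hc1, hc2⟩ := hcoef (g₀ * g₁⁻¹) hDg.1 y hy' u hu w'
    rw [hG0inv] at *
    exact forall_valued_fin_two_apply_le L v _ _ _ _ w' _ (h0le w' _) hc2 hc1 (h0le w' _) i j
  · -- `X₁₀(ι u · y)`
    intro u hu y hy'
    refine hball _ (skew_test10 σ hσσ G hG01 hG10 hG1σ (ι g₀⁻¹) hg0u hg0σ (ι u * y)) fun i j w' => ?_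
    obtain ⟨hc1, hc2⟩ := hcoef (g₁ * g₀⁻¹) hDg.2 y hy' u hu w'
    rw [hG1inv] at *
    exact forall_valued_fin_two_apply_le L v _ _ _ _ w' _ (h0le w' _) hc1 hc2 (h0le w' _) i j
  · -- `ι u · δ̃ · E₀₀`
    intro u hu
    have hz : σ (ι u * δt) = -(ι u * δt) := by rw [map_mul, hσι, hσδ, mul_neg]
    refine hball _ (skew_test00 σ G hG01 hG10 hz) fun i j w' => ?_
    obtain ⟨-, hc2⟩ := hcoef (g₀ * g₁⁻¹) hDg.1 δt (Or.inr rfl) u hu w'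
    exact forall_valued_fin_two_apply_le L v _ _ _ _ w' _ hc2 (h0le w' _) (h0le w' _) (h0le w' _) i j
  · -- `ι u · δ̃ · E₁₁`
    intro u hu
    have hz : σ (ι u * δt) = -(ι u * δt) := by rw [map_mul, hσι, hσδ, mul_neg]
    refine hball _ (skew_test11 σ G hG01 hG10 hz) fun i j w' => ?_
    obtain ⟨-, hc2⟩ := hcoef (g₀ * g₁⁻¹) hDg.1 δt (Or.inr rfl) u hu w'
    exact forall_valued_fin_two_apply_le L v _ _ _ _ w' _ (h0le w' _) (h0le w' _) (h0le w' _) hc2 i j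

/-- **EDITION 2 — THE `hdual` LETTER OF ★ p863728 `hsuppLoc_of_level` FROM ONE NUMERIC LETTER** (LEAD F0P6-plan (g15) BATCH #199 (ζ)).  For ANY level data `(lev, c, a₀)`
of the KW fold, the dual-lattice binder `hdual` of ★ `K2LiuKindWFiniteSupportLetterOfLevel.hsuppLoc_of_level` (its bytes :340–:345 at `n := 2`, token for token) follows from
the head above and ONE exponent-domination letter `hdom : max(|δ|_w,1)·exp(e(w|v)·(a₀ h v + 2·D_v − d_v)) ≤ |2|_w·|δ|_w·exp(lev h w + c w)` — plain integers off ★ (η)'s `Bad`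
(`a₀ h v ≤ lev h w + c w`); the unit `|2|_w·|δ|_w ≠ 0` cancels. [cite: Shimura1997, §18.4 Prop. 18.14] [cite: Tate1950, §2.2] [cite: KudlaRallis1994, §2] -/
theorem hdual_of_exponent_letter
    {π : ∀ v : HeightOneSpectrum (𝓞 (Fp L)), v.adicCompletion (Fp L)} (hπ : ∀ v, Valued.v (π v) = WithZero.exp (-1 : ℤ))
    (d : HeightOneSpectrum (𝓞 (Fp L)) → ℤ) (hψ : ∀ v, (adeleAddCharAt (Fp L) v).HasConductorExp (d v))
    (hg : ∀ k : Fin 2, gramR L e dV hdV dW hdW k k ≠ 0) (D : HeightOneSpectrum (𝓞 (Fp L)) → ℕ)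
    (hDg : ∀ v : HeightOneSpectrum (𝓞 (Fp L)),
      Valued.v (algebraMap (Fp L) (v.adicCompletion (Fp L)) (gramR L e dV hdV dW hdW 0 0) *
          (algebraMap (Fp L) (v.adicCompletion (Fp L)) (gramR L e dV hdV dW hdW 1 1))⁻¹) ≤ WithZero.exp (D v : ℤ) ∧
        Valued.v (algebraMap (Fp L) (v.adicCompletion (Fp L)) (gramR L e dV hdV dW hdW 1 1) *
          (algebraMap (Fp L) (v.adicCompletion (Fp L)) (gramR L e dV hdV dW hdW 0 0))⁻¹) ≤ WithZero.exp (D v : ℤ))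
    (hDδ : ∀ (v : HeightOneSpectrum (𝓞 (Fp L))) (w' : UnitaryGroup.PlacesOver L v),
      Valued.v ((imagUnit L : L) : w'.1.adicCompletion L) ≤ WithZero.exp ((v.asIdeal.ramificationIdx' w'.1.asIdeal : ℤ) * D v))
    (lev : HA L e dV hdV dW hdW → HeightOneSpectrum (𝓞 L) → ℕ) (c : HeightOneSpectrum (𝓞 L) → ℕ)
    (a₀ : HA L e dV hdV dW hdW → HeightOneSpectrum (𝓞 (Fp L)) → ℤ)
    (hdom : ∀ (h : HA L e dV hdV dW hdW) (v : HeightOneSpectrum (𝓞 (Fp L))) (w : UnitaryGroup.PlacesOver L v),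
      max (Valued.v ((imagUnit L : L) : w.1.adicCompletion L)) 1 *
          WithZero.exp ((v.asIdeal.ramificationIdx' w.1.asIdeal : ℤ) * (a₀ h v + 2 * (D v : ℤ) - d v)) ≤
        Valued.v ((2 : L) : w.1.adicCompletion L) * Valued.v ((imagUnit L : L) : w.1.adicCompletion L) * WithZero.exp (((lev h w.1 + c w.1 : ℕ) : ℤ))) :
    ∀ (S : skewMatrices ((IsCMField.complexConj L : L ≃ₐ[Fp L] L) : L →+* L) ((gramR L e dV hdV dW hdW).map (algebraMap (Fp L) L)))
      (h : HA L e dV hdV dW hdW) (v : HeightOneSpectrum (𝓞 (Fp L))) (w : UnitaryGroup.PlacesOver L v) (a b : Fin 2),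
      (∀ u₀ : ↥(unipDeltaLoc L e dV hdV dW hdW v), u₀ ∈ kindWLocalBall L e dV hdV dW hdW v (π v) (a₀ h v) →
        unipDeltaChar L e dV hdV dW hdW (S : Matrix (Fin 2) (Fin 2) L) (locToAdelic L e dV hdV dW hdW v
          (u₀ : UnitaryGroup.localPi L (IsCMField.complexConj L) (2 + 2) (hermD L e dV hdV dW hdW) v)) = 1) →
      Valued.v ((((S : Matrix (Fin 2) (Fin 2) L) a b : L)) : w.1.adicCompletion L) ≤ WithZero.exp (((lev h w.1 + c w.1 : ℕ) : ℤ)) := by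
  intro S h v w a b h1
  have hm := (valued_entry_mul_le_of_unipDeltaChar_eq_one_on_ball L e dV hdV dW hdW v (hπ v) (hψ v) hg (D v) (hDg v) (hDδ v)
    (S : Matrix (Fin 2) (Fin 2) L) S.2 (a₀ h v) h1 w a b).trans (hdom h v w)
  have h2ne : ((2 : L) : w.1.adicCompletion L) ≠ 0 := (map_ne_zero (algebraMap L (w.1.adicCompletion L))).2 (two_ne_zero : (2 : L) ≠ 0)
  have hδne : ((imagUnit L : L) : w.1.adicCompletion L) ≠ 0 := (map_ne_zero (algebraMap L (w.1.adicCompletion L))).2 (imagUnit_ne_zero L)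
  have hne : Valued.v ((2 : L) : w.1.adicCompletion L) * Valued.v ((imagUnit L : L) : w.1.adicCompletion L) ≠ 0 :=
    mul_ne_zero ((Valuation.ne_zero_iff _).2 h2ne) ((Valuation.ne_zero_iff _).2 hδne)
  calc Valued.v ((((S : Matrix (Fin 2) (Fin 2) L) a b : L)) : w.1.adicCompletion L)
      = (Valued.v ((2 : L) : w.1.adicCompletion L) * Valued.v ((imagUnit L : L) : w.1.adicCompletion L))⁻¹ *
          (Valued.v ((2 : L) : w.1.adicCompletion L) * Valued.v ((imagUnit L : L) : w.1.adicCompletion L) *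
            Valued.v ((((S : Matrix (Fin 2) (Fin 2) L) a b : L)) : w.1.adicCompletion L)) := by
        rw [← mul_assoc, inv_mul_cancel₀ hne, one_mul]
    _ ≤ (Valued.v ((2 : L) : w.1.adicCompletion L) * Valued.v ((imagUnit L : L) : w.1.adicCompletion L))⁻¹ *
          (Valued.v ((2 : L) : w.1.adicCompletion L) * Valued.v ((imagUnit L : L) : w.1.adicCompletion L) * WithZero.exp (((lev h w.1 + c w.1 : ℕ) : ℤ))) :=
        mul_le_mul_right hm _
    _ = WithZero.exp (((lev h w.1 + c w.1 : ℕ) : ℤ)) := by rw [← mul_assoc, inv_mul_cancel₀ hne, one_mul]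

end Two

end Summit.HodgeConjecture.HodgeConjecture.Cruxes.HLiu418.K2LiuKindWFiniteDualLatticeLetter

end
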